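import Literature.MathematicalPhysics.QuantumFieldTheory.Balaban1983to89.Node00.Record13SepCoPInhabitedOfThm1CCMWGaugeRAllTorus
import Summits.QuantumFields.YangMills.Theorems.BalabanUVNodesK0SignFreeOfStepTokensRCube

/-!
# BalabanUVNodes ∕ K0 ROAD ON EVERY FAMILY — K0⁷'s body from [15] Proposition 8's top step, [6] Proposition 6 at NODE 00's member and the SIGN-FREE β stub 3ᴬ ALONE:
# the small-torus rider `F.m ≤ 3` (V15–V17's stub 4, director-ym (δ)) is NOT READ by row `bg`

Seat `pub-ymgap-dag-n21-c` (g13) = FILE Cʷ″, on Cʷ′ (`…K0SignFreeOfStepTokensRCube`, p567242 — V17's registered composition `record13SepCoPHBody_of_stubsA h1 h2 h3A h4`) and this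
seat's Node00 file `Record13SepCoPInhabitedOfThm1CCMWGaugeRAllTorus` (the Bʷ∕Eʷ chain WITHOUT `hjm : j + 1 ≤ F.m`).  `--kind proof --supports stmt-QuantumFields-20541 --as helper`.
[15] = [Balaban1985Variational]; [6] = [Balaban1985RegularSpaces]; [III] = [Balaban1988Convergent]; [I] = [Balaban1987RG1]; [IIc] = [Balaban1988RG2Cluster].

WHY (plan g77 DELTA-COST 2026-08-27 l.23344 (A) STANDING QUESTION; director-ym №195 (1)).  V15–V17 carry `stub_k0SmallTorus13 : ∀ F, F.m ≤ 3 → K0HBodyAt F` because the gauge road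
(B′ `Stage13Params.bgAtDatumCoP_of_thm1RegSepCoP7M_of_thm1GaugeR`) demanded the non-wrapping binder `hsN` at EVERY length `n ≤ p.K`, and `hsN ⇔ j + 1 ≤ F.m` at the witness (A2
`hsN_theta13OfThm1CCM_iff`).  But row `bg` of `Provisos₁₃SepCoPH` is demanded only behind the window `Step.InInterval θ.γ n (gOfRecord₁₃ θ p)` AND `PartCompat₁₃ θ p n` ([III] p. 257),
and these two guards already force every [I] (1.12) cube the row reads to have side `≤ L^{m+K}` = half the torus period, ON EVERY FAMILY (`Node00.Stage13Params.hsN_of_partCompat₁₃`: in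
the window `R_j = L·t` by (2.5), `M = L^a`, `L` odd, so `L^{j+a+1} ∣ 2·L^{m+K}` gives `j + a + 1 ≤ m + K`).  So stub 4 is implied by stubs 1, 2, 3ᴬ — no rider on `T4Family`, no supersession.

WHAT THIS FILE PROVES (theorems only; 0 `def`).
§1 ★★★ `exists_k0H_of_prop8TopStep_of_prop6Member_of_clausesH_allTorus` — Cʷ′ §1 WITHOUT `hm : 4 ≤ F.m` (over `…_of_hcomp_cube_allTorus`).
§2 ★★★★ `record13SepCoPHBody_of_stubs123A (h1 : stub 1) (h2 : stub 2) (h3A : 3ᴬ) : ∀ F, ⁷-body F` — V17's texts of stubs 1, 2, 3ᴬ VERBATIM, NO stub 4; `stub4_of_stubs123A` (V17's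
   stub 4 as a COROLLARY of stubs 1–3, so V17 closes from three stubs by name: `Record13SepCoPHInhabited_of h1 h2 h3 (stub4_of_stubs123A h1 h2 h3)`); `record13SepCoPHBody_of_stubsA_iff_stubs123A`-type
   bookkeeping is left to the plan (a V18 with three stubs is its call).
§3 `record13SepCoPHBody_of_stubs12_jetsFreePair_allTorus` — end to end from stubs 1, 2 and NODE O's jets-free pair at `θ₁₅ᶜᶜᴹ(3)` (Cʷ′ `absBetaBox_of_jetsFreePair`), NO rider.

HONEST FRAMING.  Compositions of tree theorems; CONDITIONAL on [15] Prop. 8's top step (N07), [6] Prop. 6 at the member (N05) and 3ᴬ ([I] §1 p.264 ∕ Thm 2 — stated in print, proof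
unpublished; NODE O ∕ K2's pair) — all DISPLAYED hypotheses, never asserted; nothing of Bałaban asserted or discharged; K0⁷ OPEN (V17 of record; this file shows its stub 4 redundant, it
does not re-register anything); counts unmoved (typed 28∕28 · discharged 5∕27); one finite 𝕋⁴ programme at fixed ε — NOT continuum ∕ OS ∕ mass gap ∕ Clay.
No `sorry`, `def`, `instance`, `notation`.
-/

noncomputable section

open scoped Matrix.Norms.L2Operator

namespace Summit.QuantumFields.YangMills.Theorems.K0AllTorusOfStepTokensRCube

open Literature.MathematicalPhysics.QuantumFieldTheory.Balaban1983to89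
open Literature.MathematicalPhysics.QuantumFieldTheory.Balaban1983to89.Node00
open Literature.MathematicalPhysics.QuantumFieldTheory.Balaban1983to89.T4Continuum
open Literature.MathematicalPhysics.QuantumFieldTheory.Balaban1983to89.FlowStep
open Literature.MathematicalPhysics.QuantumFieldTheory.Balaban1983to89.Beta.Drift (OneLoopDrift)
open Summit.QuantumFields.BalabanUV.Gaps.BetaContFromD4Chain (AtSlopeCont)
open Summit.QuantumFields.YangMills.BalabanUVNodes.N07Thm1Top7FromProp8 (variationalThm1RegSepCoP7M_of_prop8TopStep)
open Summit.QuantumFields.YangMills.Theorems.K0ROfStepTokensRCube (shrunkCeiling_pos gauge9R_cube_of_prop8TopStep_of_prop6Member)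
open Summit.QuantumFields.YangMills.Theorems.K0SignFreeOfStepTokensRCube (clausesH_of_absBetaBox absBetaBox_of_jetsFreePair)

/-! ## §1. The ⁷ K0 body for EVERY family `F` from the two printed inputs, the signs, and the sign-free clauses at `θ₁₅ᶜᶜᴹ(3; γ)` -/

section Cube

variable (F : T4Family)

/-- **★★★ THE ⁷ K0 BODY FOR `F` — ANY `F`, NO `4 ≤ F.m` — AT `N = 2` FROM [15] PROP. 8's TOP STEP, [6] PROP. 6 AT NODE 00's MEMBER AND THE SIGN-FREE CLAUSES (hcomp) ∧ (hcompRev) AT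
`θ₁₅ᶜᶜᴹ(3; γ)`** — Cʷ′'s `exists_k0H_of_prop8TopStep_of_prop6Member_of_clausesH` with the binder `hm : 4 ≤ F.m` DROPPED, over the all-torus cube closer
`exists_k0SepCoPH_thm1CCMW_of_gauge9TopStepR_of_hcomp_cube_allTorus` (the (1.12) cubes row `bg` reads never wrap at a guarded run).  CONDITIONAL on every displayed hypothesis; K0⁷ NOT
closed here. [cite: Balaban1985Variational, Thm 1 (8)–(9) p.279, (144)–(152) pp.300–301, Prop. 8 p.304; Balaban1985RegularSpaces, Prop. 6 p.99; Balaban1988Convergent, Thm 1 p.262, (2.1) p.254, (2.5) p.255, (2.6)–(2.8) pp.255–256, p.257, (2.21) p.258; Balaban1987RG1, Thm 1 p.259, (1.12) p.262] -/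
theorem exists_k0H_of_prop8TopStep_of_prop6Member_of_clausesH_allTorus {B₃ a₀ a₁ B₁ c₁ : ℝ} (hB₃ : 2 * (F.L : ℝ) ^ 2 ≤ B₃) (ha₀ : 0 < a₀) (ha₁ : 0 < a₁)
    (h8 : Prop8RegSepTopStep F 2 (fun ν K Ω => suppDomOfRecord F ν K Ω) B₃ a₀ a₁) (hB₁ : 0 ≤ B₁) (hc₁ : 0 < c₁)
    (hP6 : letI : CStarAlgebra (MatA 2) := {}; B8.Prop6Printed 4 (F.L : ℝ) B₁ c₁ (fun i : B8LeafModelZd.ZdIdx 4 F.L => zdCub (MatA 2) F.L i))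
    {γ ε₀ ε₂₉ : ℝ} (hγ0 : 0 < γ) (hγ : γ ≤ 1 / 2) (hε : 0 < ε₀) (hε' : 0 < ε₂₉)
    (hcomp : ∀ (p : B12.RunParams) (n : ℕ), n ≤ p.K →
      Step.InInterval (theta13OfThm1CCMW F 2 3 γ ε₀ ε₂₉ B₃ (b9Of F (F.L ^ 3) B₁ * B₃) a₀ (min a₁ (a0Of F 2 (F.L ^ 3) B₁ c₁ / B₃))).γ n
        (gOfRecord₁₃ F 2 (theta13OfThm1CCMW F 2 3 γ ε₀ ε₂₉ B₃ (b9Of F (F.L ^ 3) B₁ * B₃) a₀ (min a₁ (a0Of F 2 (F.L ^ 3) B₁ c₁ / B₃))) p) → ∀ m, m < n →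
      (theta13OfThm1CCMW F 2 3 γ ε₀ ε₂₉ B₃ (b9Of F (F.L ^ 3) B₁ * B₃) a₀ (min a₁ (a0Of F 2 (F.L ^ 3) B₁ c₁ / B₃))).s2.cR *
          epsOfRecord (theta13OfThm1CCMW F 2 3 γ ε₀ ε₂₉ B₃ (b9Of F (F.L ^ 3) B₁ * B₃) a₀ (min a₁ (a0Of F 2 (F.L ^ 3) B₁ c₁ / B₃))).ν
            (gOfRecord₁₃ F 2 (theta13OfThm1CCMW F 2 3 γ ε₀ ε₂₉ B₃ (b9Of F (F.L ^ 3) B₁ * B₃) a₀ (min a₁ (a0Of F 2 (F.L ^ 3) B₁ c₁ / B₃))) p) m ≤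
        2 * ((theta13OfThm1CCMW F 2 3 γ ε₀ ε₂₉ B₃ (b9Of F (F.L ^ 3) B₁ * B₃) a₀ (min a₁ (a0Of F 2 (F.L ^ 3) B₁ c₁ / B₃))).s2.cR *
          epsOfRecord (theta13OfThm1CCMW F 2 3 γ ε₀ ε₂₉ B₃ (b9Of F (F.L ^ 3) B₁ * B₃) a₀ (min a₁ (a0Of F 2 (F.L ^ 3) B₁ c₁ / B₃))).ν
            (gOfRecord₁₃ F 2 (theta13OfThm1CCMW F 2 3 γ ε₀ ε₂₉ B₃ (b9Of F (F.L ^ 3) B₁ * B₃) a₀ (min a₁ (a0Of F 2 (F.L ^ 3) B₁ c₁ / B₃))) p) (m + 1)))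
    (hcompRev : ∀ (p : B12.RunParams) (n : ℕ), n ≤ p.K →
      Step.InInterval (theta13OfThm1CCMW F 2 3 γ ε₀ ε₂₉ B₃ (b9Of F (F.L ^ 3) B₁ * B₃) a₀ (min a₁ (a0Of F 2 (F.L ^ 3) B₁ c₁ / B₃))).γ n
        (gOfRecord₁₃ F 2 (theta13OfThm1CCMW F 2 3 γ ε₀ ε₂₉ B₃ (b9Of F (F.L ^ 3) B₁ * B₃) a₀ (min a₁ (a0Of F 2 (F.L ^ 3) B₁ c₁ / B₃))) p) → ∀ m, m < n →
      (theta13OfThm1CCMW F 2 3 γ ε₀ ε₂₉ B₃ (b9Of F (F.L ^ 3) B₁ * B₃) a₀ (min a₁ (a0Of F 2 (F.L ^ 3) B₁ c₁ / B₃))).s2.cR *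
          epsOfRecord (theta13OfThm1CCMW F 2 3 γ ε₀ ε₂₉ B₃ (b9Of F (F.L ^ 3) B₁ * B₃) a₀ (min a₁ (a0Of F 2 (F.L ^ 3) B₁ c₁ / B₃))).ν
            (gOfRecord₁₃ F 2 (theta13OfThm1CCMW F 2 3 γ ε₀ ε₂₉ B₃ (b9Of F (F.L ^ 3) B₁ * B₃) a₀ (min a₁ (a0Of F 2 (F.L ^ 3) B₁ c₁ / B₃))) p) (m + 1) ≤
        2 * ((theta13OfThm1CCMW F 2 3 γ ε₀ ε₂₉ B₃ (b9Of F (F.L ^ 3) B₁ * B₃) a₀ (min a₁ (a0Of F 2 (F.L ^ 3) B₁ c₁ / B₃))).s2.cR *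
          epsOfRecord (theta13OfThm1CCMW F 2 3 γ ε₀ ε₂₉ B₃ (b9Of F (F.L ^ 3) B₁ * B₃) a₀ (min a₁ (a0Of F 2 (F.L ^ 3) B₁ c₁ / B₃))).ν
            (gOfRecord₁₃ F 2 (theta13OfThm1CCMW F 2 3 γ ε₀ ε₂₉ B₃ (b9Of F (F.L ^ 3) B₁ * B₃) a₀ (min a₁ (a0Of F 2 (F.L ^ 3) B₁ c₁ / B₃))) p) m)) :
    ∃ θ : Stage13HParams F 2, θ.Provisos₁₃SepCoPH F 2 ∧ (θ.ZhUnity F 2 ∧ θ.SlotsNondegenerate₁₃ F 2) ∧ θ.Admissible F 2 := by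
  have hL : (0 : ℝ) < (F.L : ℝ) := by exact_mod_cast lt_trans Nat.zero_lt_one F.hL.2
  have hBpos : (0 : ℝ) < B₃ := lt_of_lt_of_le (mul_pos two_pos (pow_pos hL 2)) hB₃
  have hB9 : 0 ≤ b9Of F (F.L ^ 3) B₁ * B₃ := mul_nonneg (b9Of_pos (F := F) (F.L ^ 3) hB₁).le hBpos.le
  exact exists_k0SepCoPH_thm1CCMW_of_gauge9TopStepR_of_hcomp_cube_allTorus F hγ0 hγ hε hε' hBpos.le hB9 ha₀ (shrunkCeiling_pos F (F.L ^ 3) hBpos hB₁ hc₁ ha₁)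
    (variationalThm1RegSepCoP7M_of_prop8TopStep hBpos (h8.of_le le_rfl (min_le_left _ _))) (gauge9R_cube_of_prop8TopStep_of_prop6Member F hBpos h8 hB₁ hc₁ hP6)
    hcomp hcompRev

end Cube

/-! ## §2. ★★★★ The composition from stubs 1, 2, 3ᴬ ALONE — no small-torus rider -/

section ThreeStubs

/-- **★★★★ K0⁷'s BODY AT EVERY FAMILY from stub 1 ([15] Prop. 8's top step for SOME guarded `(B₃, a₀, a₁)`), stub 2 ([6] Prop. 6 at NODE 00's member) and THE ABS STUB 3ᴬ («for every
guarded constants tuple carrying (8) and the R step fact, SOME window `γ₀ > 0`, thresholds `ε₀, ε₂₉ > 0` and a bound `β′` with `−β′ ≤ β₁₃(θ₁₅ᶜᶜᴹ(3)) ≤ β′` on every `]0, γ₀]^{k+1}`») — AND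
NOTHING ELSE**: V17's texts of stubs 1, 2, 3ᴬ VERBATIM (Cʷ′ `record13SepCoPHBody_of_stubsA`'s `h1`, `h2`, `h3A`); its `h4 : ∀ F, F.m ≤ 3 → …` is GONE.  Proof: 3ᴬ ⟹ 3ᶜʰ (Cʷ′
`clausesH_of_absBetaBox`) ⟹ §1, for every `F` (no case split on `F.m`).  Hypothesis form, no `sorry`; CONDITIONAL; K0⁷ NOT closed; nothing of Bałaban asserted.
[cite: Balaban1985Variational, Thm 1 (8)–(9) p.279, (152) p.301, Prop. 8 p.304; Balaban1985RegularSpaces, Prop. 6 p.99; Balaban1988Convergent, Thm 1 p.262, (2.1) p.254, (2.5) p.255, (2.6)–(2.8) pp.255–256, p.257, (3.16)–(3.23) pp.268–270; Balaban1987RG1, Thm 1 p.259, §1 p.264; Balaban1989LargeFieldI, (0.2)–(0.4) p.176] -/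
theorem record13SepCoPHBody_of_stubs123A
    (h1 : ∀ F : T4Family, ∃ B₃ a₀ a₁ : ℝ, 2 * (F.L : ℝ) ^ 2 ≤ B₃ ∧ 0 < a₀ ∧ 0 < a₁ ∧
      Prop8RegSepTopStep F 2 (fun ν K Ω => suppDomOfRecord F ν K Ω) B₃ a₀ a₁)
    (h2 : ∀ F : T4Family, ∃ B₁ c₁ : ℝ, 0 ≤ B₁ ∧ 0 < c₁ ∧
      (letI : CStarAlgebra (MatA 2) := {}; B8.Prop6Printed 4 (F.L : ℝ) B₁ c₁ (fun i : B8LeafModelZd.ZdIdx 4 F.L => zdCub (MatA 2) F.L i)))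
    (h3A : ∀ (F : T4Family) (B₃ B₃' a₀ a₁ : ℝ), 2 * (F.L : ℝ) ^ 2 ≤ B₃ → 0 < B₃' → 0 < a₀ → 0 < a₁ →
      VariationalThm1RegSepCoP7M F 2 B₃ a₀ a₁ →
      Gauge9RegSepTopStepR F 2 (fun ν K Ω => suppDomOfRecord F ν K Ω) (F.L ^ 3) ((11 * 4 + 3 * F.L) * F.L) B₃ B₃' a₀ a₁ →
      ∃ γ₀ ε₀ ε₂₉ β' : ℝ, 0 < γ₀ ∧ 0 < ε₀ ∧ 0 < ε₂₉ ∧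
        BetaLowerH (-β') γ₀ (betaOfRecord₁₃ F 2 (theta13OfThm1CCM F 2 3 ε₀ ε₂₉ B₃ B₃' a₀ a₁)) ∧
        BetaUpperH β' γ₀ (betaOfRecord₁₃ F 2 (theta13OfThm1CCM F 2 3 ε₀ ε₂₉ B₃ B₃' a₀ a₁))) :
    ∀ F : T4Family, ∃ θ : Stage13HParams F 2, θ.Provisos₁₃SepCoPH F 2 ∧ (θ.ZhUnity F 2 ∧ θ.SlotsNondegenerate₁₃ F 2) ∧ θ.Admissible F 2 := by
  intro F
  obtain ⟨B₃, a₀, a₁, hB₃, ha₀, ha₁, h8⟩ := h1 F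
  have hL : (0 : ℝ) < (F.L : ℝ) := by exact_mod_cast lt_trans Nat.zero_lt_one F.hL.2
  have hBpos : (0 : ℝ) < B₃ := lt_of_lt_of_le (mul_pos two_pos (pow_pos hL 2)) hB₃
  obtain ⟨B₁, c₁, hB₁, hc₁, hP6⟩ := h2 F
  have ha₁' : 0 < min a₁ (a0Of F 2 (F.L ^ 3) B₁ c₁ / B₃) := shrunkCeiling_pos F (F.L ^ 3) hBpos hB₁ hc₁ ha₁
  have hB₉ : 0 < b9Of F (F.L ^ 3) B₁ * B₃ := mul_pos (b9Of_pos (F := F) (F.L ^ 3) hB₁) hBpos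
  obtain ⟨γ, ε₀, ε₂₉, hγ0, hγ, hε, hε', hcomp, hcompRev⟩ :=
    clausesH_of_absBetaBox F (h3A F) B₃ (b9Of F (F.L ^ 3) B₁ * B₃) a₀ (min a₁ (a0Of F 2 (F.L ^ 3) B₁ c₁ / B₃)) hB₃ hB₉ ha₀ ha₁'
      (variationalThm1RegSepCoP7M_of_prop8TopStep hBpos (h8.of_le le_rfl (min_le_left _ _))) (gauge9R_cube_of_prop8TopStep_of_prop6Member F hBpos h8 hB₁ hc₁ hP6)
  exact exists_k0H_of_prop8TopStep_of_prop6Member_of_clausesH_allTorus F hB₃ ha₀ ha₁ h8 hB₁ hc₁ hP6 hγ0 hγ hε hε' hcomp hcompRev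

/-- **V17's STUB 4 IS A COROLLARY OF STUBS 1, 2, 3ᴬ** (the small-torus branch `F.m ≤ 3` of `record13SepCoPHBody_of_stubs123A`): so the registered V17 composition closes from THREE stubs by
name — `Record13SepCoPHInhabited_of h1 h2 h3 (stub4_of_stubs123A h1 h2 h3)` — with no rider on `T4Family` and no re-registration; director-ym №195 (1) «a by-name proof of stub 4 remains
welcome» answered MODULO stubs 1–3 (nothing of Bałaban asserted). [cite: Balaban1988Convergent, Thm 1 p.262, p.257; Balaban1987RG1, (0.1) p.251 (bookkeeping)] -/
theorem stub4_of_stubs123A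
    (h1 : ∀ F : T4Family, ∃ B₃ a₀ a₁ : ℝ, 2 * (F.L : ℝ) ^ 2 ≤ B₃ ∧ 0 < a₀ ∧ 0 < a₁ ∧
      Prop8RegSepTopStep F 2 (fun ν K Ω => suppDomOfRecord F ν K Ω) B₃ a₀ a₁)
    (h2 : ∀ F : T4Family, ∃ B₁ c₁ : ℝ, 0 ≤ B₁ ∧ 0 < c₁ ∧
      (letI : CStarAlgebra (MatA 2) := {}; B8.Prop6Printed 4 (F.L : ℝ) B₁ c₁ (fun i : B8LeafModelZd.ZdIdx 4 F.L => zdCub (MatA 2) F.L i)))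
    (h3A : ∀ (F : T4Family) (B₃ B₃' a₀ a₁ : ℝ), 2 * (F.L : ℝ) ^ 2 ≤ B₃ → 0 < B₃' → 0 < a₀ → 0 < a₁ →
      VariationalThm1RegSepCoP7M F 2 B₃ a₀ a₁ →
      Gauge9RegSepTopStepR F 2 (fun ν K Ω => suppDomOfRecord F ν K Ω) (F.L ^ 3) ((11 * 4 + 3 * F.L) * F.L) B₃ B₃' a₀ a₁ →
      ∃ γ₀ ε₀ ε₂₉ β' : ℝ, 0 < γ₀ ∧ 0 < ε₀ ∧ 0 < ε₂₉ ∧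
        BetaLowerH (-β') γ₀ (betaOfRecord₁₃ F 2 (theta13OfThm1CCM F 2 3 ε₀ ε₂₉ B₃ B₃' a₀ a₁)) ∧
        BetaUpperH β' γ₀ (betaOfRecord₁₃ F 2 (theta13OfThm1CCM F 2 3 ε₀ ε₂₉ B₃ B₃' a₀ a₁))) :
    ∀ F : T4Family, F.m ≤ 3 → ∃ θ : Stage13HParams F 2, θ.Provisos₁₃SepCoPH F 2 ∧ (θ.ZhUnity F 2 ∧ θ.SlotsNondegenerate₁₃ F 2) ∧ θ.Admissible F 2 :=
  fun F _ => record13SepCoPHBody_of_stubs123A h1 h2 h3A F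

/-- **THE V17 COMPOSITION WITH ITS FOURTH ARGUMENT SUPPLIED**: Cʷ′'s `record13SepCoPHBody_of_stubsA h1 h2 h3A h4` at `h4 := stub4_of_stubs123A h1 h2 h3A` — the registered shape, three
inputs.  Bookkeeping; CONDITIONAL. [cite: Balaban1988Convergent, Thm 1 p.262 (bookkeeping)] -/
theorem record13SepCoPHBody_of_stubsA_three
    (h1 : ∀ F : T4Family, ∃ B₃ a₀ a₁ : ℝ, 2 * (F.L : ℝ) ^ 2 ≤ B₃ ∧ 0 < a₀ ∧ 0 < a₁ ∧
      Prop8RegSepTopStep F 2 (fun ν K Ω => suppDomOfRecord F ν K Ω) B₃ a₀ a₁)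
    (h2 : ∀ F : T4Family, ∃ B₁ c₁ : ℝ, 0 ≤ B₁ ∧ 0 < c₁ ∧
      (letI : CStarAlgebra (MatA 2) := {}; B8.Prop6Printed 4 (F.L : ℝ) B₁ c₁ (fun i : B8LeafModelZd.ZdIdx 4 F.L => zdCub (MatA 2) F.L i)))
    (h3A : ∀ (F : T4Family) (B₃ B₃' a₀ a₁ : ℝ), 2 * (F.L : ℝ) ^ 2 ≤ B₃ → 0 < B₃' → 0 < a₀ → 0 < a₁ →
      VariationalThm1RegSepCoP7M F 2 B₃ a₀ a₁ →
      Gauge9RegSepTopStepR F 2 (fun ν K Ω => suppDomOfRecord F ν K Ω) (F.L ^ 3) ((11 * 4 + 3 * F.L) * F.L) B₃ B₃' a₀ a₁ →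
      ∃ γ₀ ε₀ ε₂₉ β' : ℝ, 0 < γ₀ ∧ 0 < ε₀ ∧ 0 < ε₂₉ ∧
        BetaLowerH (-β') γ₀ (betaOfRecord₁₃ F 2 (theta13OfThm1CCM F 2 3 ε₀ ε₂₉ B₃ B₃' a₀ a₁)) ∧
        BetaUpperH β' γ₀ (betaOfRecord₁₃ F 2 (theta13OfThm1CCM F 2 3 ε₀ ε₂₉ B₃ B₃' a₀ a₁))) :
    ∀ F : T4Family, ∃ θ : Stage13HParams F 2, θ.Provisos₁₃SepCoPH F 2 ∧ (θ.ZhUnity F 2 ∧ θ.SlotsNondegenerate₁₃ F 2) ∧ θ.Admissible F 2 :=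
  K0SignFreeOfStepTokensRCube.record13SepCoPHBody_of_stubsA h1 h2 h3A (stub4_of_stubs123A h1 h2 h3A)

end ThreeStubs

/-! ## §3. End to end from stubs 1, 2 and NODE O's jets-free pair at `θ₁₅ᶜᶜᴹ(3)` — no rider -/

section Supplier

/-- **★★★★ END TO END, SIGN-FREE, ON EVERY FAMILY**: stub 1, stub 2 and NODE O's jets-free pair at A1's witness `θ₁₅ᶜᶜᴹ(3)` for every family and every guarded tuple ⟹ K0⁷'s body at every
family — Cʷ′'s `record13SepCoPHBody_of_stubs12_jetsFreePair_rider` WITHOUT the rider (`absBetaBox_of_jetsFreePair` ∘ `record13SepCoPHBody_of_stubs123A`).  CONDITIONAL; K0⁷ NOT closed;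
nothing of Bałaban asserted; no sign of β anywhere. [cite: Balaban1985Variational, Thm 1 (8)–(9) p.279, Prop. 8 p.304; Balaban1985RegularSpaces, Prop. 6 p.99; Balaban1988Convergent, Thm 1 p.262, (2.6)–(2.8) pp.255–256, p.257; Balaban1987RG1, Thm 1 p.259, Thm 2 p.259, §1 p.264, (2.12)–(2.14) p.268, (5.10) p.293; Balaban1988RG2Cluster, Lemma 3 (2.38) p.20] -/
theorem record13SepCoPHBody_of_stubs12_jetsFreePair_allTorus
    (h1 : ∀ F : T4Family, ∃ B₃ a₀ a₁ : ℝ, 2 * (F.L : ℝ) ^ 2 ≤ B₃ ∧ 0 < a₀ ∧ 0 < a₁ ∧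
      Prop8RegSepTopStep F 2 (fun ν K Ω => suppDomOfRecord F ν K Ω) B₃ a₀ a₁)
    (h2 : ∀ F : T4Family, ∃ B₁ c₁ : ℝ, 0 ≤ B₁ ∧ 0 < c₁ ∧
      (letI : CStarAlgebra (MatA 2) := {}; B8.Prop6Printed 4 (F.L : ℝ) B₁ c₁ (fun i : B8LeafModelZd.ZdIdx 4 F.L => zdCub (MatA 2) F.L i)))
    (h3J : ∀ (F : T4Family) (B₃ B₃' a₀ a₁ : ℝ), 2 * (F.L : ℝ) ^ 2 ≤ B₃ → 0 < B₃' → 0 < a₀ → 0 < a₁ →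
      VariationalThm1RegSepCoP7M F 2 B₃ a₀ a₁ →
      Gauge9RegSepTopStepR F 2 (fun ν K Ω => suppDomOfRecord F ν K Ω) (F.L ^ 3) ((11 * 4 + 3 * F.L) * F.L) B₃ B₃' a₀ a₁ →
      ∃ ε₀ ε₂₉ : ℝ, 0 < ε₀ ∧ 0 < ε₂₉ ∧
        (letI := (theta13OfThm1CCM F 2 3 ε₀ ε₂₉ B₃ B₃' a₀ a₁).instVβ₁; letI := (theta13OfThm1CCM F 2 3 ε₀ ε₂₉ B₃ B₃' a₀ a₁).instVβ₂;
         letI := (theta13OfThm1CCM F 2 3 ε₀ ε₂₉ B₃ B₃' a₀ a₁).instιβ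
         ∃ d A : ℝ, 0 ≤ d ∧
           OneLoopDrift d A (beta0OfMerged (betaMerged F (mergedTermFamilyMatT F 2 (TcanOfRecord F 2)
             (chiFixed29 F 2 (theta13OfThm1CCM F 2 3 ε₀ ε₂₉ B₃ B₃' a₀ a₁).ν (theta13OfThm1CCM F 2 3 ε₀ ε₂₉ B₃ B₃' a₀ a₁).ε₂₉) (theta13OfThm1CCM F 2 3 ε₀ ε₂₉ B₃ B₃' a₀ a₁).εbg)
             (theta13OfThm1CCM F 2 3 ε₀ ε₂₉ B₃ B₃' a₀ a₁).ρ8 (theta13OfThm1CCM F 2 3 ε₀ ε₂₉ B₃ B₃' a₀ a₁).bV) (theta13OfThm1CCM F 2 3 ε₀ ε₂₉ B₃ B₃' a₀ a₁).v₀) ∧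
           ∃ γ₀ : ℝ, 0 < γ₀ ∧ γ₀ ≤ (theta13OfThm1CCM F 2 3 ε₀ ε₂₉ B₃ B₃' a₀ a₁).γ ∧
             AtSlopeCont
               (oneLoopSplit_betaOfMerged
                 (betaMerged F (mergedTermFamilyMatT F 2 (TcanOfRecord F 2)
                   (chiFixed29 F 2 (theta13OfThm1CCM F 2 3 ε₀ ε₂₉ B₃ B₃' a₀ a₁).ν (theta13OfThm1CCM F 2 3 ε₀ ε₂₉ B₃ B₃' a₀ a₁).ε₂₉) (theta13OfThm1CCM F 2 3 ε₀ ε₂₉ B₃ B₃' a₀ a₁).εbg)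
                   (theta13OfThm1CCM F 2 3 ε₀ ε₂₉ B₃ B₃' a₀ a₁).ρ8 (theta13OfThm1CCM F 2 3 ε₀ ε₂₉ B₃ B₃' a₀ a₁).bV)
                 (beta0OfMerged (betaMerged F (mergedTermFamilyMatT F 2 (TcanOfRecord F 2)
                   (chiFixed29 F 2 (theta13OfThm1CCM F 2 3 ε₀ ε₂₉ B₃ B₃' a₀ a₁).ν (theta13OfThm1CCM F 2 3 ε₀ ε₂₉ B₃ B₃' a₀ a₁).ε₂₉) (theta13OfThm1CCM F 2 3 ε₀ ε₂₉ B₃ B₃' a₀ a₁).εbg)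
                   (theta13OfThm1CCM F 2 3 ε₀ ε₂₉ B₃ B₃' a₀ a₁).ρ8 (theta13OfThm1CCM F 2 3 ε₀ ε₂₉ B₃ B₃' a₀ a₁).bV) (theta13OfThm1CCM F 2 3 ε₀ ε₂₉ B₃ B₃' a₀ a₁).v₀)
                 (theta13OfThm1CCM F 2 3 ε₀ ε₂₉ B₃ B₃' a₀ a₁).γ)
               γ₀ d)) :
    ∀ F : T4Family, ∃ θ : Stage13HParams F 2, θ.Provisos₁₃SepCoPH F 2 ∧ (θ.ZhUnity F 2 ∧ θ.SlotsNondegenerate₁₃ F 2) ∧ θ.Admissible F 2 :=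
  record13SepCoPHBody_of_stubs123A h1 h2 (fun F => absBetaBox_of_jetsFreePair F (h3J F))

end Supplier

end Summit.QuantumFields.YangMills.Theorems.K0AllTorusOfStepTokensRCube

end
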